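import Literature.Probability.RandomPlanarGeometry.SAWFiniteMemoryZ3Kernel
import Mathlib.Tactic.IntervalCases
import Mathlib.Tactic.LinearCombination
import HarnessLib

/-!
# Kernel certificates for `μ(ℤ³)` on SYMMETRY-REDUCED tries: the 48 lattice symmetries of `ℤ³`

Topic `Literature/Probability/RandomPlanarGeometry` (continues `SAWFiniteMemoryZ3Kernel.lean`; the three-dimensional twin of
`SAWFiniteMemoryKernelSymm.lean`). Pönitz–Tittmann (2000, §3) reduce their finite-memory automaton by the lattice symmetries
("we exploit this kind of symmetry by normalizing states … states whose normalized representatives are the same could be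
collected since they exhibit equal weights"). On `ℤ³` the symmetry group is the hyperoctahedral group of order `48` (a permutation
of the three axes and three signs), so the reduction is `≈ 48×`: the memory-`10` automaton `FiniteMemory3.ptStep 10` has `139 183`
states but only `≈ 3·10³` orbits — one kernel data file instead of a `native_decide`.

* `symOf3 i` (`i < 48`) — the symmetries as maps of the letter alphabet `Fin 3 × Bool` (`perm3 (i / 8)` permutes the axes, bit `j`
  of `i % 8` flips the sign on axis `j`); `comp3`, `inv3` — explicit composition / inverse numbers, checked pointwise by `decide`;
* `phiP3 g` — the induced linear map of `ℤ³`; **`ptStep_map3`**: `ptStep K (g·s) (g a) = g·(ptStep K s a)` (equivariance of the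
  Pönitz–Tittmann automaton: its rule is stated in `ℓ¹`-distances only, and the `symOf3 i` are `ℓ¹`-isometries);
* the reduced 6-ary trie certificate: payload `w·48⁶ + c` (`WTrie3.B w c …` in the data files) = weight `w = pw3 n` and, per letter `a`,
  the number `pg3 n a < 48` of the symmetry carrying the successor `ptStep K s a` onto its tabulated orbit representative;
  `verifyStateS3`, `verifyNodesS3`, **`verifyTS3`**; glue `verifyTS3_of_children` / `verifyNodesS3_of_children`, `WTrie3.subtrie`;
* soundness **`certificate_of_verifyTS3`** with the symmetric weight `symW3 t s` (least positive tabulated weight on the orbit of `s`),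
  `count_three_mul_pow_le_of_verifyTS3` (`cₙ Dⁿ ≤ Nⁿ 2⁴¹`) and **`connectiveConstant_three_le_of_verifyTS3`** (`μ(ℤ³) ≤ N/D`).

## References

* [PonitzTittmann2000] A. Pönitz, P. Tittmann, *Improved upper bounds for self-avoiding walks in ℤᵈ*, Electron. J. Combin. 7
  (2000) R21, §2 (automaton), §3 (p. 6–7: normalizing states; eigenvalue bound), Table 2 (p. 9, `d = 3`: `4.8646, 4.8075, 4.7780,
  4.7599, 4.7476, 4.7387` for `k = 4, …, 14`).
* L. Collatz, *Einschließungssatz für die charakteristischen Zahlen von Matrizen*, Math. Z. 48 (1942) 221–226.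
-/

open Finset Filter Topology Literature.Probability.LatticeModels
open scoped BigOperators

namespace Literature.Probability.RandomPlanarGeometry.SAW.Zd

namespace FiniteMemory3

/-! ### The 48 symmetries of `ℤ³` on the letter alphabet -/

/-- The permutation of the three axes with number `p` (`0` = identity, `1,2,3` = transpositions, `4,5` = 3-cycles; any
`p ≥ 5` is the last one). [cite: PonitzTittmann2000, §3] -/
def perm3 : ℕ → Fin 3 → Fin 3
  | 0 => fun j => j
  | 1 => fun j => if j = 0 then 1 else if j = 1 then 0 else 2
  | 2 => fun j => if j = 0 then 2 else if j = 2 then 0 else 1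
  | 3 => fun j => if j = 1 then 2 else if j = 2 then 1 else 0
  | 4 => fun j => if j = 0 then 1 else if j = 1 then 2 else 0
  | _ => fun j => if j = 0 then 2 else if j = 1 then 0 else 1

/-- **The lattice symmetry with number `i`** on the letters `±e_j = (j, ±)`: permute the axis by `perm3 (i / 8)` and flip the sign
on axis `j` iff bit `j` of `i % 8` is set. The `48` numbers `i < 48` enumerate the hyperoctahedral group. [cite: PonitzTittmann2000, §3] -/
def symOf3 (i : ℕ) (a : Fin 3 × Bool) : Fin 3 × Bool :=
  (perm3 (i / 8) a.1, Bool.xor a.2 ((i % 8).testBit a.1.val))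

/-- The number of the axis permutation with images `(π 0, π 1, π 2) = (x, y, z)`. [cite: PonitzTittmann2000, §3] -/
def permIndex (x y _z : Fin 3) : ℕ :=
  if x = 0 then (if y = 1 then 0 else 3)
  else if x = 1 then (if y = 0 then 1 else 4)
  else (if y = 1 then 2 else 5)

/-- **Composition number**: `symOf3 (comp3 i j) = symOf3 j ∘ symOf3 i` (checked pointwise in `symOf3_comp3`).
[cite: PonitzTittmann2000, §3] -/
def comp3 (i j : ℕ) : ℕ :=
  let p := perm3 (i / 8)
  let q := perm3 (j / 8)
  let e := i % 8
  let f := j % 8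
  8 * permIndex (q (p 0)) (q (p 1)) (q (p 2)) +
    ((Bool.xor (e.testBit 0) (f.testBit (p 0).val)).toNat + 2 * (Bool.xor (e.testBit 1) (f.testBit (p 1).val)).toNat +
      4 * (Bool.xor (e.testBit 2) (f.testBit (p 2).val)).toNat)

/-- **Inverse number**: `symOf3 (inv3 i)` is the two-sided inverse of `symOf3 i` (checked pointwise in `symOf3_inv3`).
[cite: PonitzTittmann2000, §3] -/
def inv3 (i : ℕ) : ℕ :=
  ((List.range 48).find? fun k =>
      letters.all fun a => decide (symOf3 k (symOf3 i a) = a) && decide (symOf3 i (symOf3 k a) = a)).getD 0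

/-- Closure under composition, pointwise (decided). [cite: PonitzTittmann2000, §3] -/
theorem symOf3_comp3 : ∀ i < 48, ∀ j < 48, comp3 i j < 48 ∧ ∀ a : Fin 3 × Bool, symOf3 (comp3 i j) a = symOf3 j (symOf3 i a) := by
  decide +kernel

/-- Inverses, pointwise (decided). [cite: PonitzTittmann2000, §3] -/
theorem symOf3_inv3 : ∀ i < 48, inv3 i < 48 ∧ (∀ a : Fin 3 × Bool, symOf3 (inv3 i) (symOf3 i a) = a) ∧
    ∀ a : Fin 3 × Bool, symOf3 i (symOf3 (inv3 i) a) = a := by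
  decide +kernel

/-- The symmetries (as a predicate on maps of the alphabet). [cite: PonitzTittmann2000, §3] -/
def IsSym3 (g : Fin 3 × Bool → Fin 3 × Bool) : Prop := ∃ i < 48, g = symOf3 i

/-- `symOf3 i` is a symmetry for `i < 48`. [cite: PonitzTittmann2000, §3] -/
theorem isSym3_symOf3 {i : ℕ} (hi : i < 48) : IsSym3 (symOf3 i) := ⟨i, hi, rfl⟩

/-- Closure under composition: `h ∘ g` is a symmetry. [cite: PonitzTittmann2000, §3] -/
theorem IsSym3.comp {g h : Fin 3 × Bool → Fin 3 × Bool} (hg : IsSym3 g) (hh : IsSym3 h) :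
    ∃ k, IsSym3 k ∧ ∀ a, k a = h (g a) := by
  obtain ⟨i, hi, rfl⟩ := hg
  obtain ⟨j, hj, rfl⟩ := hh
  obtain ⟨hlt, hk⟩ := symOf3_comp3 i hi j hj
  exact ⟨symOf3 (comp3 i j), ⟨_, hlt, rfl⟩, hk⟩

/-- Inverses: every symmetry has a two-sided inverse among the symmetries. [cite: PonitzTittmann2000, §3] -/
theorem IsSym3.inv {g : Fin 3 × Bool → Fin 3 × Bool} (hg : IsSym3 g) :
    ∃ g', IsSym3 g' ∧ (∀ a, g' (g a) = a) ∧ ∀ a, g (g' a) = a := by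
  obtain ⟨i, hi, rfl⟩ := hg
  obtain ⟨hlt, h1, h2⟩ := symOf3_inv3 i hi
  exact ⟨symOf3 (inv3 i), ⟨_, hlt, rfl⟩, h1, h2⟩

/-- Right division: given symmetries `g, k` there is a symmetry `h` with `h ∘ g = k`. [cite: PonitzTittmann2000, §3] -/
theorem IsSym3.div {g k : Fin 3 × Bool → Fin 3 × Bool} (hg : IsSym3 g) (hk : IsSym3 k) :
    ∃ h, IsSym3 h ∧ ∀ a, h (g a) = k a := by
  obtain ⟨g', hg', h1, -⟩ := hg.inv
  obtain ⟨h, hh, hha⟩ := hg'.comp hk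
  exact ⟨h, hh, fun a => by rw [hha, h1]⟩

/-! ### Geometry of the symmetries -/

/-- The linear map of `ℤ³` induced by a symmetry `g` of the alphabet: it sends `e_j` to the step vector of `g (j, +)`.
[cite: PonitzTittmann2000, §3] -/
def phiP3 (g : Fin 3 × Bool → Fin 3 × Bool) (p : ℤ × ℤ × ℤ) : ℤ × ℤ × ℤ :=
  (p.1 * dz (g (0, true)) 0 + p.2.1 * dz (g (1, true)) 0 + p.2.2 * dz (g (2, true)) 0,
    p.1 * dz (g (0, true)) 1 + p.2.1 * dz (g (1, true)) 1 + p.2.2 * dz (g (2, true)) 1,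
    p.1 * dz (g (0, true)) 2 + p.2.1 * dz (g (1, true)) 2 + p.2.2 * dz (g (2, true)) 2)

/-- `phiP3 g` fixes the origin. [cite: PonitzTittmann2000, §3] -/
@[simp] theorem phiP3_zero (g : Fin 3 × Bool → Fin 3 × Bool) : phiP3 g (0, 0, 0) = (0, 0, 0) := by
  simp [phiP3]

/-- The step vectors transform like the letters (decided on the `48 × 6 × 3` cases). [cite: PonitzTittmann2000, §3] -/
private theorem dz_symOf3 : ∀ n < 48, ∀ a : Fin 3 × Bool, ∀ i : Fin 3,
    dz a 0 * dz (symOf3 n (0, true)) i + dz a 1 * dz (symOf3 n (1, true)) i + dz a 2 * dz (symOf3 n (2, true)) i =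
      dz (symOf3 n a) i := by
  decide +kernel

/-- **Equivariance of one step**: `phiP3 g (p + e_a) = phiP3 g p + e_{g a}`. [cite: PonitzTittmann2000, §3] -/
theorem phiP3_pmove {g : Fin 3 × Bool → Fin 3 × Bool} (hg : IsSym3 g) (a : Fin 3 × Bool) (p : ℤ × ℤ × ℤ) :
    phiP3 g (pmove a p) = pmove (g a) (phiP3 g p) := by
  obtain ⟨n, hn, rfl⟩ := hg
  obtain ⟨x, y, z⟩ := p
  have h0 := dz_symOf3 n hn a 0
  have h1 := dz_symOf3 n hn a 1
  have h2 := dz_symOf3 n hn a 2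
  simp only [phiP3, pmove, Prod.mk.injEq]
  refine ⟨?_, ?_, ?_⟩
  · linear_combination h0
  · linear_combination h1
  · linear_combination h2

/-- The symmetries are `ℓ¹`-isometries of `ℤ³` (48 cases). [cite: PonitzTittmann2000, §3] -/
theorem dist1_phiP3 {g : Fin 3 × Bool → Fin 3 × Bool} (hg : IsSym3 g) (p q : ℤ × ℤ × ℤ) :
    dist1 (phiP3 g p) (phiP3 g q) = dist1 p q := by
  obtain ⟨n, hn, rfl⟩ := hg
  obtain ⟨x, y, z⟩ := p
  obtain ⟨x', y', z'⟩ := q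
  interval_cases n <;> simp [phiP3, symOf3, perm3, dz, dist1, Nat.testBit] <;> omega

/-- The symmetries are injective on `ℤ³`. [cite: PonitzTittmann2000, §3] -/
theorem phiP3_injective {g : Fin 3 × Bool → Fin 3 × Bool} (hg : IsSym3 g) : Function.Injective (phiP3 g) := by
  intro p q h
  have h0 : dist1 (phiP3 g p) (phiP3 g q) = 0 := by rw [h]; simp [dist1]
  rw [dist1_phiP3 hg] at h0
  obtain ⟨x, y, z⟩ := p; obtain ⟨x', y', z'⟩ := q
  simp only [dist1, Prod.mk.injEq] at h0 ⊢; omega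

/-- Endpoint of the image word. [cite: PonitzTittmann2000, §3] -/
theorem pEnd_map3 {g : Fin 3 × Bool → Fin 3 × Bool} (hg : IsSym3 g) (s : List (Fin 3 × Bool)) :
    pEnd (s.map g) = phiP3 g (pEnd s) := by
  suffices key : ∀ q : ℤ × ℤ × ℤ, (s.map g).foldl (fun p a => pmove a p) (phiP3 g q) =
      phiP3 g (s.foldl (fun p a => pmove a p) q) by
    have := key (0, 0, 0); rw [phiP3_zero] at this; exact this
  induction s with
  | nil => intro q; rfl
  | cons a s ih => intro q; rw [List.map_cons, List.foldl_cons, List.foldl_cons, ← phiP3_pmove hg, ih]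

/-- Vertices of the image word. [cite: PonitzTittmann2000, §3] -/
theorem pVerts_map3 {g : Fin 3 × Bool → Fin 3 × Bool} (hg : IsSym3 g) (s : List (Fin 3 × Bool)) :
    pVerts (s.map g) = (pVerts s).map (phiP3 g) := by
  suffices key : ∀ q : ℤ × ℤ × ℤ, (s.map g).scanl (fun p a => pmove a p) (phiP3 g q) =
      (s.scanl (fun p a => pmove a p) q).map (phiP3 g) by
    have := key (0, 0, 0); rw [phiP3_zero] at this; exact this
  induction s with
  | nil => intro q; rfl
  | cons a s ih =>
    intro q; rw [List.map_cons, List.scanl_cons, List.scanl_cons, List.map_cons, ← phiP3_pmove hg, ih]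

/-- **Equivariance of the Pönitz–Tittmann automaton on `ℤ³`** under the 48 lattice symmetries:
`ptStep K (g·s) (g a) = g·(ptStep K s a)`. [cite: PonitzTittmann2000, §3] -/
theorem ptStep_map3 {g : Fin 3 × Bool → Fin 3 × Bool} (hg : IsSym3 g) (K : ℕ) (s : List (Fin 3 × Bool))
    (a : Fin 3 × Bool) : ptStep K (s.map g) (g a) = (ptStep K s a).map (List.map g) := by
  unfold ptStep
  simp only [pEnd_map3 hg, pVerts_map3 hg, ← phiP3_pmove hg, List.length_map]
  have hmem : (phiP3 g (pmove a (pEnd s)) ∈ (pVerts s).map (phiP3 g)) ↔ pmove a (pEnd s) ∈ pVerts s := by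
    rw [List.mem_map]
    exact ⟨fun ⟨q, hq, he⟩ => by rw [← phiP3_injective hg he]; exact hq, fun h => ⟨_, h, rfl⟩⟩
  by_cases h : pmove a (pEnd s) ∈ pVerts s
  · rw [if_pos (hmem.2 h), if_pos h]; rfl
  · rw [if_neg (fun h' => h (hmem.1 h')), if_neg h, Option.map_some]
    congr 1
    have hp : ((fun pi : (ℤ × ℤ × ℤ) × ℕ => decide (K < s.length + 1 - pi.2 + dist1 pi.1 (phiP3 g (pmove a (pEnd s))))) ∘
        Prod.map (phiP3 g) id) =
        (fun pi : (ℤ × ℤ × ℤ) × ℕ => decide (K < s.length + 1 - pi.2 + dist1 pi.1 (pmove a (pEnd s)))) := by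
      funext pi
      simp only [Function.comp_apply, Prod.map_fst, Prod.map_snd, id_eq, dist1_phiP3 hg]
    rw [List.zipIdx_map, List.takeWhile_map, List.length_map, hp,
      show List.map g s ++ [g a] = (s ++ [a]).map g by simp, List.map_drop]

/-! ### Literal abbreviations, sub-tries, payload decoding -/

namespace WTrie3

/-- Abbreviation for data files: the empty sub-trie. [cite: PonitzTittmann2000, §3] -/
def Z : WTrie3 := WTrie3.nil

/-- Abbreviation for data files: a leaf with weight `w` and symmetry codes `c` (payload `w·48⁶ + c`). [cite: PonitzTittmann2000, §3] -/
def L (w c : ℕ) : WTrie3 := WTrie3.node (w * 12230590464 + c) Z Z Z Z Z Z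

/-- Abbreviation for data files: a branch node with weight `w` and symmetry codes `c` (payload `w·48⁶ + c`). [cite: PonitzTittmann2000, §3] -/
def B (w c : ℕ) (c₀ c₁ c₂ c₃ c₄ c₅ : WTrie3) : WTrie3 := WTrie3.node (w * 12230590464 + c) c₀ c₁ c₂ c₃ c₄ c₅

/-- The sub-trie below the word `s` (`nil` if absent); used to NAME the pieces of a split kernel evaluation.
[cite: PonitzTittmann2000, §3] -/
def subtrie : WTrie3 → List (Fin 3 × Bool) → WTrie3
  | t, [] => t
  | nil, _ :: _ => nil
  | node _ c₀ c₁ c₂ c₃ c₄ c₅, a :: s => subtrie (child c₀ c₁ c₂ c₃ c₄ c₅ a) s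

end WTrie3

/-- The weight part of a node payload `n = w·48⁶ + c`. [cite: PonitzTittmann2000, §3] -/
def pw3 (n : ℕ) : ℕ := n / 12230590464

/-- The position of a letter in the order `+e₀, -e₀, +e₁, -e₁, +e₂, -e₂`. [cite: PonitzTittmann2000, §3] -/
def lidx (a : Fin 3 × Bool) : ℕ := 2 * a.1.val + (if a.2 then 0 else 1)

/-- The symmetry number (`< 48`) recorded for the letter `a` in a node payload (base-`48` digit `lidx a`).
[cite: PonitzTittmann2000, §3] -/
def pg3 (n : ℕ) (a : Fin 3 × Bool) : ℕ := n / 48 ^ lidx a % 48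

/-- The recorded symmetry numbers are `< 48`. [cite: PonitzTittmann2000, §3] -/
theorem pg3_lt (n : ℕ) (a : Fin 3 × Bool) : pg3 n a < 48 := Nat.mod_lt _ (by norm_num)

/-! ### The verifier -/

/-- Check of one tabulated representative `s`: positive weight; for every letter `a` with a successor `b = ptStep K s a`, the
image of `b` under the recorded symmetry is tabulated with positive weight; and `D · Σ_a w(image of successor) ≤ N · w(s)`.
[cite: PonitzTittmann2000, §3] -/
def verifyStateS3 (K N D : ℕ) (t : WTrie3) (s : List (Fin 3 × Bool)) : Bool :=
  decide (1 ≤ pw3 (t.find s)) &&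
    letters.all (fun a =>
      match ptStep K s a with
      | none => true
      | some b => decide (1 ≤ pw3 (t.find (b.map (symOf3 (pg3 (t.find s) a)))))) &&
    decide (D * (letters.map fun a =>
        ((ptStep K s a).map fun b => pw3 (t.find (b.map (symOf3 (pg3 (t.find s) a))))).getD 0).sum ≤
      N * pw3 (t.find s))

/-- Structural traversal of the trie: every node of positive weight, at the word `pre.reverse`, passes `verifyStateS3`
against the whole trie `root`. [cite: PonitzTittmann2000, §3] -/
def verifyNodesS3 (K N D : ℕ) (root : WTrie3) : WTrie3 → List (Fin 3 × Bool) → Bool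
  | WTrie3.nil, _ => true
  | WTrie3.node n c₀ c₁ c₂ c₃ c₄ c₅, pre =>
    (decide (pw3 n = 0) || verifyStateS3 K N D root pre.reverse) &&
      verifyNodesS3 K N D root c₀ (((0 : Fin 3), true) :: pre) && verifyNodesS3 K N D root c₁ (((0 : Fin 3), false) :: pre) &&
      verifyNodesS3 K N D root c₂ (((1 : Fin 3), true) :: pre) && verifyNodesS3 K N D root c₃ (((1 : Fin 3), false) :: pre) &&
      verifyNodesS3 K N D root c₄ (((2 : Fin 3), true) :: pre) && verifyNodesS3 K N D root c₅ (((2 : Fin 3), false) :: pre)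

/-- **The reduced trie certificate check on `ℤ³`**: root weight in `[1, 2⁴¹]` and every node of positive weight passes
`verifyStateS3`. Evaluated by `decide +kernel` in the data files. [cite: PonitzTittmann2000, §3] -/
def verifyTS3 (K N D : ℕ) (t : WTrie3) : Bool :=
  decide (1 ≤ pw3 (t.find [])) && decide (pw3 (t.find []) ≤ 2 ^ 41) && verifyNodesS3 K N D t t []

/-! ### Glue for split kernel evaluations -/

/-- The traversal of an absent sub-trie succeeds. [cite: PonitzTittmann2000, §3] -/
@[simp] theorem verifyNodesS3_nil (K N D : ℕ) (root : WTrie3) (pre : List (Fin 3 × Bool)) :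
    verifyNodesS3 K N D root WTrie3.nil pre = true := rfl

/-- The traversal of `WTrie3.Z` succeeds. [cite: PonitzTittmann2000, §3] -/
@[simp] theorem verifyNodesS3_Z (K N D : ℕ) (root : WTrie3) (pre : List (Fin 3 × Bool)) :
    verifyNodesS3 K N D root WTrie3.Z pre = true := rfl

/-- **Node glue**: a node passes the traversal if its own state check passes (or its weight is `0`) and its six sub-tries pass
(separate kernel evaluations). [cite: PonitzTittmann2000, §3] -/
theorem verifyNodesS3_of_children {K N D n : ℕ} {root c₀ c₁ c₂ c₃ c₄ c₅ : WTrie3} {pre : List (Fin 3 × Bool)}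
    (hs : (decide (pw3 n = 0) || verifyStateS3 K N D root pre.reverse) = true)
    (g₀ : verifyNodesS3 K N D root c₀ (((0 : Fin 3), true) :: pre) = true)
    (g₁ : verifyNodesS3 K N D root c₁ (((0 : Fin 3), false) :: pre) = true)
    (g₂ : verifyNodesS3 K N D root c₂ (((1 : Fin 3), true) :: pre) = true)
    (g₃ : verifyNodesS3 K N D root c₃ (((1 : Fin 3), false) :: pre) = true)
    (g₄ : verifyNodesS3 K N D root c₄ (((2 : Fin 3), true) :: pre) = true)
    (g₅ : verifyNodesS3 K N D root c₅ (((2 : Fin 3), false) :: pre) = true) :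
    verifyNodesS3 K N D root (WTrie3.node n c₀ c₁ c₂ c₃ c₄ c₅) pre = true := by
  simp only [verifyNodesS3, Bool.and_eq_true]
  exact ⟨⟨⟨⟨⟨⟨hs, g₀⟩, g₁⟩, g₂⟩, g₃⟩, g₄⟩, g₅⟩

/-- **Root glue**: root weight in `[1, 2⁴¹]`, root state check, and the six sub-trie traversals give `verifyTS3`.
[cite: PonitzTittmann2000, §3] -/
theorem verifyTS3_of_children {K N D n : ℕ} {c₀ c₁ c₂ c₃ c₄ c₅ : WTrie3} (h1 : 1 ≤ pw3 n) (h2 : pw3 n ≤ 2 ^ 41)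
    (hr : verifyStateS3 K N D (WTrie3.node n c₀ c₁ c₂ c₃ c₄ c₅) [] = true)
    (g₀ : verifyNodesS3 K N D (WTrie3.node n c₀ c₁ c₂ c₃ c₄ c₅) c₀ [((0 : Fin 3), true)] = true)
    (g₁ : verifyNodesS3 K N D (WTrie3.node n c₀ c₁ c₂ c₃ c₄ c₅) c₁ [((0 : Fin 3), false)] = true)
    (g₂ : verifyNodesS3 K N D (WTrie3.node n c₀ c₁ c₂ c₃ c₄ c₅) c₂ [((1 : Fin 3), true)] = true)
    (g₃ : verifyNodesS3 K N D (WTrie3.node n c₀ c₁ c₂ c₃ c₄ c₅) c₃ [((1 : Fin 3), false)] = true)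
    (g₄ : verifyNodesS3 K N D (WTrie3.node n c₀ c₁ c₂ c₃ c₄ c₅) c₄ [((2 : Fin 3), true)] = true)
    (g₅ : verifyNodesS3 K N D (WTrie3.node n c₀ c₁ c₂ c₃ c₄ c₅) c₅ [((2 : Fin 3), false)] = true) :
    verifyTS3 K N D (WTrie3.node n c₀ c₁ c₂ c₃ c₄ c₅) = true := by
  have hw0 : ¬ pw3 n = 0 := by omega
  simp only [verifyTS3, verifyNodesS3, WTrie3.find, List.reverse_nil, Bool.and_eq_true, Bool.or_eq_true,
    decide_eq_true_eq]
  exact ⟨⟨h1, h2⟩, ⟨⟨⟨⟨⟨Or.inr hr, g₀⟩, g₁⟩, g₂⟩, g₃⟩, g₄⟩, g₅⟩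

/-! ### Soundness of the traversal -/

/-- A word `pre.reverse ++ s` of positive weight in the sub-trie `t` passes the state check. [cite: PonitzTittmann2000, §3] -/
private theorem verifyStateS3_of_verifyNodesS3 {K N D : ℕ} {root : WTrie3} :
    ∀ (t : WTrie3) (pre s : List (Fin 3 × Bool)), verifyNodesS3 K N D root t pre = true → 1 ≤ pw3 (t.find s) →
      verifyStateS3 K N D root (pre.reverse ++ s) = true
  | WTrie3.nil, pre, s, _, h => by simp [WTrie3.find, pw3] at h
  | WTrie3.node n c₀ c₁ c₂ c₃ c₄ c₅, pre, [], hc, h => by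
    simp only [verifyNodesS3, Bool.and_eq_true, Bool.or_eq_true, decide_eq_true_eq] at hc
    simp only [WTrie3.find] at h
    rcases hc.1.1.1.1.1.1 with h0 | hv
    · omega
    · simpa using hv
  | WTrie3.node n c₀ c₁ c₂ c₃ c₄ c₅, pre, a :: s, hc, h => by
    simp only [verifyNodesS3, Bool.and_eq_true] at hc
    obtain ⟨⟨⟨⟨⟨⟨-, h0⟩, h1⟩, h2⟩, h3⟩, h4⟩, h5⟩ := hc
    have hfind : (WTrie3.node n c₀ c₁ c₂ c₃ c₄ c₅).find (a :: s) = (WTrie3.child c₀ c₁ c₂ c₃ c₄ c₅ a).find s := rfl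
    rw [hfind] at h
    have key : ∀ (c : WTrie3), verifyNodesS3 K N D root c (a :: pre) = true →
        WTrie3.find c s = WTrie3.find (WTrie3.child c₀ c₁ c₂ c₃ c₄ c₅ a) s →
        verifyStateS3 K N D root (pre.reverse ++ a :: s) = true := by
      intro c hcov he
      have := verifyStateS3_of_verifyNodesS3 c (a :: pre) s hcov (by rw [he]; exact h)
      simpa using this
    obtain ⟨i, b⟩ := a
    fin_cases i <;> cases b
    · exact key c₁ h1 rfl
    · exact key c₀ h0 rfl
    · exact key c₃ h3 rfl
    · exact key c₂ h2 rfl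
    · exact key c₅ h5 rfl
    · exact key c₄ h4 rfl

/-! ### The symmetric weight -/

/-- The images of a word under the 48 symmetries. [cite: PonitzTittmann2000, §3] -/
def images3 (s : List (Fin 3 × Bool)) : List (List (Fin 3 × Bool)) := (List.range 48).map fun i => s.map (symOf3 i)

/-- Membership in the images. [cite: PonitzTittmann2000, §3] -/
private theorem mem_images3 {s b : List (Fin 3 × Bool)} : b ∈ images3 s ↔ ∃ g, IsSym3 g ∧ b = s.map g := by
  simp only [images3, List.mem_map, List.mem_range, IsSym3]
  constructor
  · rintro ⟨i, hi, rfl⟩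
    exact ⟨symOf3 i, ⟨i, hi, rfl⟩, rfl⟩
  · rintro ⟨g, ⟨i, hi, rfl⟩, rfl⟩
    exact ⟨i, hi, rfl⟩

/-- The images of an image are the images (as a finset). [cite: PonitzTittmann2000, §3] -/
private theorem images3_toFinset_map {g : Fin 3 × Bool → Fin 3 × Bool} (hg : IsSym3 g) (s : List (Fin 3 × Bool)) :
    (images3 (s.map g)).toFinset = (images3 s).toFinset := by
  ext b
  rw [List.mem_toFinset, List.mem_toFinset, mem_images3, mem_images3]
  constructor
  · rintro ⟨h, hh, rfl⟩
    obtain ⟨k, hk, hkd⟩ := hg.comp hh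
    exact ⟨k, hk, by rw [List.map_map]; exact List.map_congr_left fun d _ => (hkd d).symm⟩
  · rintro ⟨k, hk, rfl⟩
    obtain ⟨h, hh, hhd⟩ := hg.div hk
    exact ⟨h, hh, by rw [List.map_map]; exact List.map_congr_left fun d _ => (hhd d).symm⟩

/-- The positive tabulated weights on the orbit of `s`. [cite: PonitzTittmann2000, §3] -/
def orbitW3 (t : WTrie3) (s : List (Fin 3 × Bool)) : Finset ℕ :=
  ((images3 s).toFinset.image fun b => pw3 (t.find b)).filter fun w => 0 < w

/-- **The symmetric weight** read off a reduced table: the least positive tabulated weight on the orbit of `s` (`0` if no image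
is tabulated). Never evaluated; it is the weight function of the soundness theorem. [cite: PonitzTittmann2000, §3] -/
def symW3 (t : WTrie3) (s : List (Fin 3 × Bool)) : ℕ :=
  if h : (orbitW3 t s).Nonempty then (orbitW3 t s).min' h else 0

/-- The orbit weights are invariant under the symmetries. [cite: PonitzTittmann2000, §3] -/
theorem orbitW3_map (t : WTrie3) {g : Fin 3 × Bool → Fin 3 × Bool} (hg : IsSym3 g) (s : List (Fin 3 × Bool)) :
    orbitW3 t (s.map g) = orbitW3 t s := by
  unfold orbitW3
  rw [images3_toFinset_map hg]

/-- **The symmetric weight is invariant under the symmetries.** [cite: PonitzTittmann2000, §3] -/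
theorem symW3_map (t : WTrie3) {g : Fin 3 × Bool → Fin 3 × Bool} (hg : IsSym3 g) (s : List (Fin 3 × Bool)) :
    symW3 t (s.map g) = symW3 t s := by
  unfold symW3
  simp only [orbitW3_map t hg]

/-- A positive tabulated weight of an image lies in the orbit weights. [cite: PonitzTittmann2000, §3] -/
theorem mem_orbitW3 {t : WTrie3} {g : Fin 3 × Bool → Fin 3 × Bool} (hg : IsSym3 g) {s : List (Fin 3 × Bool)}
    (h : 0 < pw3 (t.find (s.map g))) : pw3 (t.find (s.map g)) ∈ orbitW3 t s := by
  unfold orbitW3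
  rw [Finset.mem_filter, Finset.mem_image]
  exact ⟨⟨s.map g, List.mem_toFinset.2 (mem_images3.2 ⟨g, hg, rfl⟩), rfl⟩, h⟩

/-- The symmetric weight is at most every orbit weight. [cite: PonitzTittmann2000, §3] -/
theorem symW3_le {t : WTrie3} {s : List (Fin 3 × Bool)} {w : ℕ} (hw : w ∈ orbitW3 t s) : symW3 t s ≤ w := by
  unfold symW3
  rw [dif_pos ⟨w, hw⟩]
  exact Finset.min'_le _ _ hw

/-- The symmetric weight is positive as soon as some orbit weight is. [cite: PonitzTittmann2000, §3] -/
theorem symW3_pos {t : WTrie3} {s : List (Fin 3 × Bool)} {w : ℕ} (hw : w ∈ orbitW3 t s) : 0 < symW3 t s := by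
  unfold symW3
  rw [dif_pos ⟨w, hw⟩]
  have hm := Finset.min'_mem (orbitW3 t s) ⟨w, hw⟩
  unfold orbitW3 at hm
  exact (Finset.mem_filter.1 hm).2

/-- A positive symmetric weight is attained on the orbit. [cite: PonitzTittmann2000, §3] -/
theorem exists_map_eq_symW3 {t : WTrie3} {s : List (Fin 3 × Bool)} (h : 0 < symW3 t s) :
    ∃ g, IsSym3 g ∧ pw3 (t.find (s.map g)) = symW3 t s := by
  unfold symW3 at h ⊢
  by_cases hne : (orbitW3 t s).Nonempty
  · rw [dif_pos hne] at h ⊢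
    have hm := Finset.min'_mem (orbitW3 t s) hne
    unfold orbitW3 at hm
    obtain ⟨hm1, -⟩ := Finset.mem_filter.1 hm
    obtain ⟨b, hb, hbw⟩ := Finset.mem_image.1 hm1
    obtain ⟨g, hg, rfl⟩ := mem_images3.1 (List.mem_toFinset.1 hb)
    exact ⟨g, hg, by unfold orbitW3; exact hbw⟩
  · rw [dif_neg hne] at h
    exact absurd h (lt_irrefl 0)

/-- The symmetric weight of the initial state is its tabulated weight (when positive). [cite: PonitzTittmann2000, §3] -/
theorem symW3_nil {t : WTrie3} (h : 0 < pw3 (t.find [])) : symW3 t [] = pw3 (t.find []) := by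
  have h0 : IsSym3 (symOf3 0) := isSym3_symOf3 (by norm_num)
  have hmem : pw3 (t.find (([] : List (Fin 3 × Bool)).map (symOf3 0))) ∈ orbitW3 t [] := mem_orbitW3 h0 (by simpa using h)
  refine le_antisymm (by simpa using symW3_le hmem) ?_
  obtain ⟨g, -, hg⟩ := exists_map_eq_symW3 (symW3_pos hmem)
  rw [List.map_nil] at hg
  exact hg.le

/-! ### Soundness -/

/-- **Soundness of `verifyTS3`**: a successful reduced check yields a Collatz–Wielandt certificate for `ptStep K` on the set of
states with positive symmetric weight, with weight function `symW3 t` and `symW3 t [] ≤ 2⁴¹`; the inequalities checked at one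
representative per orbit are transported by `ptStep_map3`. [cite: PonitzTittmann2000, §3] -/
theorem certificate_of_verifyTS3 {K N D : ℕ} {t : WTrie3} (h : verifyTS3 K N D t = true) :
    WordAutomaton.Certificate (ptStep K) {s | 1 ≤ symW3 t s} (symW3 t) N D ∧ symW3 t [] ≤ 2 ^ 41 := by
  simp only [verifyTS3, Bool.and_eq_true, decide_eq_true_eq] at h
  obtain ⟨⟨h0, hroot⟩, hnodes⟩ := h
  -- the check of a tabulated representative, unpacked
  have key : ∀ s₁ : List (Fin 3 × Bool), 1 ≤ pw3 (t.find s₁) →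
      (∀ a b, ptStep K s₁ a = some b → 1 ≤ pw3 (t.find (b.map (symOf3 (pg3 (t.find s₁) a))))) ∧
      D * ∑ a : Fin 3 × Bool, ((ptStep K s₁ a).map fun b => pw3 (t.find (b.map (symOf3 (pg3 (t.find s₁) a))))).getD 0
        ≤ N * pw3 (t.find s₁) := by
    intro s₁ hs
    have hst : verifyStateS3 K N D t s₁ = true := by
      have := verifyStateS3_of_verifyNodesS3 t [] s₁ hnodes hs
      simpa using this
    simp only [verifyStateS3, Bool.and_eq_true, decide_eq_true_eq, List.all_eq_true] at hst
    obtain ⟨⟨-, hsucc⟩, hcw⟩ := hst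
    refine ⟨fun a b hb => ?_, ?_⟩
    · have := hsucc a (mem_letters a)
      rw [hb] at this
      simpa using this
    · rw [← sum_letters_map]
      exact hcw
  -- a recorded image of a successor, composed with the orbit symmetry, is again an image
  have compose : ∀ {h : Fin 3 × Bool → Fin 3 × Bool}, IsSym3 h → ∀ (i : ℕ), i < 48 → ∀ (b : List (Fin 3 × Bool)),
      ∃ k, IsSym3 k ∧ (b.map h).map (symOf3 i) = b.map k := by
    intro h hh i hi b
    obtain ⟨k, hk, hkd⟩ := hh.comp (isSym3_symOf3 hi)
    exact ⟨k, hk, by rw [List.map_map]; exact List.map_congr_left fun d _ => (hkd d).symm⟩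
  have hnil : symW3 t [] = pw3 (t.find []) := symW3_nil h0
  refine ⟨⟨?_, ?_, ?_, ?_⟩, by rw [hnil]; exact hroot⟩
  · show 1 ≤ symW3 t []
    rw [hnil]; exact h0
  · -- closure
    rintro s (hs : 1 ≤ symW3 t s) a b hb
    obtain ⟨g, hg, hgs⟩ := exists_map_eq_symW3 hs
    have hs₁ : 1 ≤ pw3 (t.find (s.map g)) := by rw [hgs]; exact hs
    have hstep : ptStep K (s.map g) (g a) = some (b.map g) := by
      rw [ptStep_map3 hg, hb, Option.map_some]
    have h1 := (key _ hs₁).1 (g a) (b.map g) hstep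
    obtain ⟨k, hk, hkb⟩ := compose hg (pg3 (t.find (s.map g)) (g a)) (pg3_lt _ _) b
    rw [hkb] at h1
    show 1 ≤ symW3 t b
    exact symW3_pos (mem_orbitW3 hk h1)
  · intro s hs
    exact hs
  · -- the Collatz–Wielandt inequality, transported along the orbit
    rintro s (hs : 1 ≤ symW3 t s)
    obtain ⟨g, hg, hgs⟩ := exists_map_eq_symW3 hs
    have hs₁ : 1 ≤ pw3 (t.find (s.map g)) := by rw [hgs]; exact hs
    obtain ⟨g', -, hinv1, hinv2⟩ := hg.inv
    set s₁ := s.map g with hs₁_def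
    let G : Fin 3 × Bool → ℕ := fun a' =>
      ((ptStep K s₁ a').map fun b => pw3 (t.find (b.map (symOf3 (pg3 (t.find s₁) a'))))).getD 0
    have hcw : D * ∑ a', G a' ≤ N * pw3 (t.find s₁) := (key s₁ hs₁).2
    have hterm : ∀ a : Fin 3 × Bool, ((ptStep K s a).map (symW3 t)).getD 0 ≤ G (g a) := by
      intro a
      show _ ≤ ((ptStep K s₁ (g a)).map _).getD 0
      rw [hs₁_def, ptStep_map3 hg]
      cases hb : ptStep K s a with
      | none => simp
      | some b =>
        simp only [Option.map_some, Option.getD_some]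
        have h1 := (key s₁ hs₁).1 (g a) (b.map g) (by rw [hs₁_def, ptStep_map3 hg, hb, Option.map_some])
        obtain ⟨k, hk, hkb⟩ := compose hg (pg3 (t.find s₁) (g a)) (pg3_lt _ _) b
        rw [hs₁_def] at hkb
        rw [hkb] at h1 ⊢
        exact symW3_le (mem_orbitW3 hk h1)
    have hsum : ∑ a : Fin 3 × Bool, ((ptStep K s a).map (symW3 t)).getD 0 ≤ ∑ a', G a' := by
      calc ∑ a : Fin 3 × Bool, ((ptStep K s a).map (symW3 t)).getD 0 ≤ ∑ a : Fin 3 × Bool, G (g a) :=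
            Finset.sum_le_sum fun a _ => hterm a
        _ = ∑ a', G a' := Equiv.sum_comp ⟨g, g', hinv1, hinv2⟩ G
    calc D * ∑ a : Fin 3 × Bool, ((ptStep K s a).map (symW3 t)).getD 0 ≤ D * ∑ a', G a' :=
          Nat.mul_le_mul_left _ hsum
      _ ≤ N * pw3 (t.find s₁) := hcw
      _ = N * symW3 t s := by rw [hgs]

/-- **`cₙ(ℤ³) · Dⁿ ≤ Nⁿ · 2⁴¹`** from a successful reduced trie certificate check. [cite: PonitzTittmann2000, §3] -/
theorem count_three_mul_pow_le_of_verifyTS3 {K N D : ℕ} {t : WTrie3} (h : verifyTS3 K N D t = true) (n : ℕ) :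
    count 3 n * D ^ n ≤ N ^ n * 2 ^ 41 := by
  obtain ⟨hc, hroot⟩ := certificate_of_verifyTS3 h
  exact le_trans (WordAutomaton.count_mul_pow_le hc (run_ne_none_of_isSAW K) n) (Nat.mul_le_mul_left _ hroot)

/-- **`μ(ℤ³) ≤ N/D` from a successful reduced trie certificate check (kernel).** [cite: PonitzTittmann2000, §3 and Table 2 (d = 3)] -/
theorem connectiveConstant_three_le_of_verifyTS3 {K N D : ℕ} {t : WTrie3} (h : verifyTS3 K N D t = true) (hD : 0 < D) :
    connectiveConstant 3 ≤ (N : ℝ) / D := by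
  refine connectiveConstant_le_of_count_le (d := 3) (C := (2 : ℝ) ^ 41) (by positivity) (by positivity) fun n _ => ?_
  have h1 := count_three_mul_pow_le_of_verifyTS3 h n
  have h2 : (count 3 n : ℝ) * (D : ℝ) ^ n ≤ (N : ℝ) ^ n * 2 ^ 41 := by exact_mod_cast h1
  have hDn : (0 : ℝ) < (D : ℝ) ^ n := by positivity
  rw [div_pow, mul_div_assoc', le_div_iff₀ hDn]
  linarith

end FiniteMemory3

end Literature.Probability.RandomPlanarGeometry.SAW.Zd
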